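import Summits.BirchSwinnertonDyer.BirchSwinnertonDyer.Theorems.ResidualThetaTransportAtTwoThetaLayerLambdaCongruenceAtTwoLayerHecke
import HarnessLib

/-!
# Crux `ThetaLayerLambdaCongruenceAtTwo` (stmt-BirchSwinnertonDyer-20688), line `birth` v4: the DEPLETED layer elements obey the
# three-term relation; (μ♮) `stub_depletedLayerMuTwo` follows from ONE even layer

Width seat bsd-wall-rtt-p3-w3 (`--supports stmt-BirchSwinnertonDyer-20688`; closes nothing). THEOREMS ONLY, route-independent.

For a newform `g` on `Γ₀(M)` (`2 ∤ M`, `a₂(g) = 0`), an embedding `ι`, a plus period `Ω` and a finite set `S₀` of odd places, the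
crux's `S₀`-DEPLETED layer element is `Θ^{S₀}_n(g;Ω) = (θ_n(g;Ω)^ι · ∏_{v∈S₀} E_{v,n}) %ₘ ω_n`, with the layer-`n` Euler factors
`E_{v,n} = (1 − ι a_ℓ X + 𝟙_{ℓ∤M} ℓ X²)∘(ℓ⁻¹(X+1)^{e_{v,n}})`, `e_{v,n} = (−f_ℓ mod 2ⁿ)`, `ω_n = (X+1)^{2ⁿ} − 1`.

## What is proved

* §1 congruence plumbing: `e_{v,n+2} ≡ e_{v,n} (mod 2ⁿ)` (`PadicInt.cast_toZModPow`), hence `E_{v,n+2} ≡ E_{v,n}` and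
  `∏ E_{v,n+2} ≡ ∏ E_{v,n} (mod ω_n)`; `((X+1)^{2ⁿ}+1)·ω_n = ω_{n+1}`; `(F %ₘ ω_{n+2}) %ₘ ω_{n+1} = F %ₘ ω_{n+1}`.
* §2 **DEPLETED THREE-TERM RELATION** `depletedPartnerLayer_three_term`:
  `Θ^{S₀}_{n+2}(g;Ω) %ₘ ω_{n+1} = −((X+1)^{2ⁿ} + 1)·Θ^{S₀}_n(g;Ω)` — from the undepleted relation (`…LayerHecke`) because the
  depletion factors are compatible along the tower and `ν_n ω_n = ω_{n+1}`. NO Euler-factor `λ` computation is involved.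
* §3 **DEPLETED GROWTH** at a COHOMOLOGICAL period: if `‖Θ^{S₀}_n(g;Ω)‖_sup = ‖2‖₂` then `‖Θ^{S₀}_{n+2}(g;Ω)‖_sup = ‖2‖₂` and
  `λ(Θ^{S₀}_{n+2}(g;Ω)) = λ(Θ^{S₀}_n(g;Ω)) + 2ⁿ` (`depletedPartnerLayer_growth`); iterated: `…_growth_mul`
  (`3λ_{n+2k} + 2ⁿ = 3λ_n + 2ⁿ·4^k` — the depleted analytic layer law of the route's TWO-LAYER PLAN, constant fixed by ONE layer).
* CONSEQUENCE (companion file `…MuOneLayer`): the registered stub (μ♮) `stub_depletedLayerMuTwo` of skeleton v4 — «for all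
  large even `n`, `‖Θ^{S₀}_n(g;Ω)‖_sup = ‖2‖₂`» — follows from (μ₁) «ONE even layer `n₁` with `‖Θ^{S₀}_{n₁}(g;Ω)‖_sup = ‖2‖₂`»;
  for each concrete partner `(g, ι)` and `S₀` that is a finite computation.

Nothing about any curve or form is asserted; BSD is not proved by any of this.

References: [PollackWeston2011MT] Prop. 2.5, §3.1, Thm. 4.1; [GreenbergVatsal2000] §1–§2 (imprimitive elements along the tower);
[MazurTateTeitelbaum1986Invent] §I.4, §I.13.
-/

noncomputable section

-- justification: the `Summit.BirchSwinnertonDyer.BirchSwinnertonDyer.…` path repeats a component (route-file convention)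
set_option linter.dupNamespace false

open scoped Classical

open Polynomial

open Literature.NumberTheory.IwasawaTheory Literature.NumberTheory.EllipticCurves
  Literature.NumberTheory.EllipticCurves.ModularForms

namespace Summit.BirchSwinnertonDyer.BirchSwinnertonDyer.Theorems.ThetaLayerLambdaCongruenceAtTwo

/-! ## §1. Congruence plumbing along the tower -/

section Plumbing

variable {K : Type*} [CommRing K]

/-- `ω ∣ A − B ⟹ ω ∣ Q(A) − Q(B)` (`A − B ∣ A^j − B^j` termwise). [folklore] -/
theorem dvd_comp_sub_comp (Q A B ω : K[X]) (h : ω ∣ A - B) : ω ∣ Q.comp A - Q.comp B := by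
  rw [comp_eq_sum_left, comp_eq_sum_left, Polynomial.sum_def, Polynomial.sum_def, ← Finset.sum_sub_distrib]
  refine Finset.dvd_sum fun j _ ↦ ?_
  rw [← mul_sub]
  exact Dvd.dvd.mul_left (h.trans (sub_dvd_pow_sub_pow A B j)) _

/-- `ω ∣ A_i − B_i` for all `i ∈ s` ⟹ `ω ∣ ∏ A_i − ∏ B_i`. [folklore] -/
theorem dvd_prod_sub_prod {α : Type*} (s : Finset α) (A B : α → K[X]) (ω : K[X])
    (h : ∀ i ∈ s, ω ∣ A i - B i) : ω ∣ ∏ i ∈ s, A i - ∏ i ∈ s, B i := by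
  classical
  induction s using Finset.induction_on with
  | empty => simp
  | insert a s ha ih =>
    rw [Finset.prod_insert ha, Finset.prod_insert ha,
      show A a * ∏ i ∈ s, A i - B a * ∏ i ∈ s, B i =
        A a * (∏ i ∈ s, A i - ∏ i ∈ s, B i) + (A a - B a) * ∏ i ∈ s, B i by ring]
    exact dvd_add (Dvd.dvd.mul_left (ih fun i hi ↦ h i (Finset.mem_insert_of_mem hi)) _)
      (Dvd.dvd.mul_right (h a (Finset.mem_insert_self a s)) _)

/-- `(X+1)^{2ⁿ} − 1 ∣ (X+1)^{a + 2ⁿ q} − (X+1)^a`. [folklore] -/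
theorem layerModulus_dvd_pow_add_sub_pow (n a q : ℕ) :
    ((X + 1 : K[X]) ^ 2 ^ n - 1) ∣ (X + 1 : K[X]) ^ (a + 2 ^ n * q) - (X + 1) ^ a := by
  rw [pow_add, pow_mul, show (X + 1 : K[X]) ^ a * ((X + 1) ^ 2 ^ n) ^ q - (X + 1) ^ a =
    (X + 1) ^ a * (((X + 1) ^ 2 ^ n) ^ q - 1 ^ q) by ring]
  exact Dvd.dvd.mul_left (by simpa using sub_dvd_pow_sub_pow ((X + 1 : K[X]) ^ 2 ^ n) 1 q) _

/-- `((X+1)^{2ⁿ} + 1)·ω_n = ω_{n+1}`. [folklore] -/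
theorem X_add_one_pow_add_one_mul_layerModulus (n : ℕ) :
    ((X + 1 : K[X]) ^ 2 ^ n + 1) * ((X + 1) ^ 2 ^ n - 1) = (X + 1) ^ 2 ^ (n + 1) - 1 := by
  rw [pow_succ, pow_mul]
  ring

/-- `ω_{n+1} ∣ ω_{n+2}`. [folklore] -/
theorem layerModulus_dvd_layerModulus_succ (n : ℕ) :
    ((X + 1 : K[X]) ^ 2 ^ n - 1) ∣ (X + 1) ^ 2 ^ (n + 1) - 1 :=
  ⟨(X + 1) ^ 2 ^ n + 1, by rw [← X_add_one_pow_add_one_mul_layerModulus, mul_comm]⟩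

/-- The layer exponents are compatible: `(x mod 2^{n+2}).val = (x mod 2ⁿ).val + 2ⁿ·q` for some `q`. [folklore] -/
theorem exists_val_toZModPow_add_two_eq (n : ℕ) (x : ℤ_[2]) :
    ∃ q : ℕ, (PadicInt.toZModPow (n + 2) x).val = (PadicInt.toZModPow n x).val + 2 ^ n * q := by
  have hle : n ≤ n + 2 := by omega
  have hcast : (ZMod.castHom (pow_dvd_pow 2 hle) (ZMod (2 ^ n))) (PadicInt.toZModPow (n + 2) x) =
      PadicInt.toZModPow n x := by
    rw [← RingHom.comp_apply, PadicInt.zmod_cast_comp_toZModPow _ _ hle]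
  have hval : (PadicInt.toZModPow n x).val = (PadicInt.toZModPow (n + 2) x).val % 2 ^ n := by
    rw [← hcast, ZMod.castHom_apply, ZMod.cast_eq_val, ZMod.val_natCast]
  refine ⟨(PadicInt.toZModPow (n + 2) x).val / 2 ^ n, ?_⟩
  rw [hval]
  exact (Nat.mod_add_div _ _).symm

end Plumbing

/-! ## §2. The depleted three-term relation -/

section Depleted

/-- `(X+1)^{2^k} − 1` over a field is monic (private helper). [folklore] -/
private theorem monic_X_add_one_pow_two_pow_sub_one_field (K : Type*) [Field K] (k : ℕ) :
    ((X + 1 : K[X]) ^ 2 ^ k - 1).Monic := by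
  have e : (X + 1 : K[X]) = X + C 1 := by rw [C_1]
  have hlt : (1 : K[X]).natDegree < ((X + 1 : K[X]) ^ 2 ^ k).natDegree := by
    rw [e, natDegree_pow, natDegree_X_add_C, mul_one, natDegree_one]; exact pow_pos two_pos _
  exact Monic.sub_of_left (by rw [e]; exact (monic_X_add_C 1).pow _) (degree_lt_degree hlt)

variable {M : ℕ} [NeZero M] {g : CuspForm (CongruenceSubgroup.Gamma0 M) 2}
  (ι : coeffField g →+* PadicAlgCl 2) (Ω : ℂ)
  (S₀ : Finset (IsDedekindDomain.HeightOneSpectrum (NumberField.RingOfIntegers ℚ)))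

omit [NeZero M] in
/-- **The depletion Euler products are compatible along the tower**: `ω_n ∣ ∏_v E_{v,n+2} − ∏_v E_{v,n}` (each factor is a
polynomial in `ℓ⁻¹(X+1)^{e}` and `e_{v,n+2} ≡ e_{v,n} mod 2ⁿ`, `(X+1)^{2ⁿ} ≡ 1 mod ω_n`). [cite: GreenbergVatsal2000, §2 (imprimitive factors along the cyclotomic tower; shape)] -/
theorem layerModulus_dvd_eulerProduct_add_two_sub (n : ℕ) :
    ((X + 1 : (PadicAlgCl 2)[X]) ^ 2 ^ n - 1) ∣ ∏ v ∈ S₀, (1 - Polynomial.C (Literature.NumberTheory.EllipticCurves.embCoeff g ι (Rat.HeightOneSpectrum.natGenerator v)) * Polynomial.X + (if Rat.HeightOneSpectrum.natGenerator v ∣ M then 0 else Polynomial.C (Rat.HeightOneSpectrum.natGenerator v : PadicAlgCl 2)) * Polynomial.X ^ 2).comp (Polynomial.C ((Rat.HeightOneSpectrum.natGenerator v : PadicAlgCl 2)⁻¹) * (Polynomial.X + 1) ^ (PadicInt.toZModPow (n + 2) (-(Literature.NumberTheory.EllipticCurves.GreenbergVatsal2000.frobeniusExponent 2 (Rat.HeightOneSpectrum.natGenerator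 v : ℤ_[2])))).val) - ∏ v ∈ S₀, (1 - Polynomial.C (Literature.NumberTheory.EllipticCurves.embCoeff g ι (Rat.HeightOneSpectrum.natGenerator v)) * Polynomial.X + (if Rat.HeightOneSpectrum.natGenerator v ∣ M then 0 else Polynomial.C (Rat.HeightOneSpectrum.natGenerator v : PadicAlgCl 2)) * Polynomial.X ^ 2).comp (Polynomial.C ((Rat.HeightOneSpectrum.natGenerator v : PadicAlgCl 2)⁻¹) * (Polynomial.X + 1) ^ (PadicInt.toZModPow n (-(Literature.NumberTheory.EllipticCurves.GreenbergVatsal2000.frobeniusExponent 2 (Rat.HeightOneSpectrum.natGenerator v : ℤ_[2])))).val) := by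
  refine dvd_prod_sub_prod _ _ _ _ fun v _ ↦ dvd_comp_sub_comp _ _ _ _ ?_
  obtain ⟨q, hq⟩ := exists_val_toZModPow_add_two_eq n
    (-(Literature.NumberTheory.EllipticCurves.GreenbergVatsal2000.frobeniusExponent 2
      (Rat.HeightOneSpectrum.natGenerator v : ℤ_[2])))
  rw [hq, ← mul_sub]
  exact Dvd.dvd.mul_left (layerModulus_dvd_pow_add_sub_pow n _ q) _

/-- **DEPLETED THREE-TERM RELATION at `p = 2`, `a₂ = 0`.** For a newform `g` on `Γ₀(M)`, `2 ∤ M`, `a₂(g) = 0`, a plus period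
`Ω`, an embedding `ι` and any finite set of places `S₀`: `Θ^{S₀}_{n+2}(g;Ω) %ₘ ω_{n+1} = −((X+1)^{2ⁿ} + 1)·Θ^{S₀}_n(g;Ω)`.
PROOF: modulo `ω_{n+1}`: `Θ_{n+2} ≡ θ_{n+2}^ι·E^{(n+2)}`; `θ_{n+2}^ι ≡ −ν_n θ_n^ι` (undepleted three-term relation, `…LayerHecke`);
`ν_n·(θ_n^ι E^{(n+2)}) ≡ ν_n·(θ_n^ι E^{(n)}) ≡ ν_n·Θ_n` because `E^{(n+2)} ≡ E^{(n)}` and `θ_n^ι E^{(n)} ≡ Θ_n` modulo `ω_n` and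
`ν_n ω_n = ω_{n+1}`; finally `deg(ν_n Θ_n) < 2^{n+1}`. [cite: PollackWeston2011MT, Prop. 2.5 (three-term relation, a_p = 0; read at 2 for imprimitive elements)] -/
theorem depletedPartnerLayer_three_term (hg : IsNewform0 g) (h2M : ¬ 2 ∣ M) (ha2 : cuspCoeff g 2 = 0)
    (hΩ : IsPlusPeriod g Ω) (n : ℕ) :
    (((Literature.NumberTheory.EllipticCurves.mazurTateElementK g Ω 2 (n + 2)).map ι * ∏ v ∈ S₀, (1 - Polynomial.C (Literature.NumberTheory.EllipticCurves.embCoeff g ι (Rat.HeightOneSpectrum.natGenerator v)) * Polynomial.X + (if Rat.HeightOneSpectrum.natGenerator v ∣ M then 0 else Polynomial.C (Rat.HeightOneSpectrum.natGenerator v : PadicAlgCl 2)) * Polynomial.X ^ 2).comp (Polynomial.C ((Rat.HeightOneSpectrum.natGenerator v : PadicAlgCl 2)⁻¹) * (Polynomial.X + 1) ^ (PadicInt.toZModPow (n + 2) (-(Literature.NumberTheory.EllipticCurves.GreenbergVatsal2000.frobeniusExponent 2 (Rat.HeightOneSpectrum.natGenerator v : ℤ_[2])))).val)) %ₘ ((Polynomial.X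 + 1) ^ 2 ^ (n + 2) - 1)) %ₘ ((X + 1) ^ 2 ^ (n + 1) - 1) = -(((X + 1) ^ 2 ^ n + 1) * (((Literature.NumberTheory.EllipticCurves.mazurTateElementK g Ω 2 n).map ι * ∏ v ∈ S₀, (1 - Polynomial.C (Literature.NumberTheory.EllipticCurves.embCoeff g ι (Rat.HeightOneSpectrum.natGenerator v)) * Polynomial.X + (if Rat.HeightOneSpectrum.natGenerator v ∣ M then 0 else Polynomial.C (Rat.HeightOneSpectrum.natGenerator v : PadicAlgCl 2)) * Polynomial.X ^ 2).comp (Polynomial.C ((Rat.HeightOneSpectrum.natGenerator v : PadicAlgCl 2)⁻¹) * (Polynomial.X + 1) ^ (PadicInt.toZModPow n (-(Literature.NumberTheory.EllipticCurves.GreenbergVatsal2000.frobeniusExponent 2 (Rat.HeightOneSpectrum.natGenerator v : ℤ_[2])))).val)) %ₘ ((Polynomial.X + 1) ^ 2 ^ n - 1))) := by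
  -- names
  set ν : (PadicAlgCl 2)[X] := (X + 1) ^ 2 ^ n + 1 with hν
  set ω0 : (PadicAlgCl 2)[X] := (X + 1) ^ 2 ^ n - 1 with hω0
  set ω1 : (PadicAlgCl 2)[X] := (X + 1) ^ 2 ^ (n + 1) - 1 with hω1
  set ω2 : (PadicAlgCl 2)[X] := (X + 1) ^ 2 ^ (n + 2) - 1 with hω2
  set E0 : (PadicAlgCl 2)[X] := ∏ v ∈ S₀, (1 - Polynomial.C (Literature.NumberTheory.EllipticCurves.embCoeff g ι (Rat.HeightOneSpectrum.natGenerator v)) * Polynomial.X + (if Rat.HeightOneSpectrum.natGenerator v ∣ M then 0 else Polynomial.C (Rat.HeightOneSpectrum.natGenerator v : PadicAlgCl 2)) * Polynomial.X ^ 2).comp (Polynomial.C ((Rat.HeightOneSpectrum.natGenerator v : PadicAlgCl 2)⁻¹) * (Polynomial.X + 1) ^ (PadicInt.toZModPow n (-(Literature.NumberTheory.EllipticCurves.GreenbergVatsal2000.frobeniusExponent 2 (Rat.HeightOneSpectrum.natGenerator v : ℤ_[2])))).val) with hE0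
  set E2 : (PadicAlgCl 2)[X] := ∏ v ∈ S₀, (1 - Polynomial.C (Literature.NumberTheory.EllipticCurves.embCoeff g ι (Rat.HeightOneSpectrum.natGenerator v)) * Polynomial.X + (if Rat.HeightOneSpectrum.natGenerator v ∣ M then 0 else Polynomial.C (Rat.HeightOneSpectrum.natGenerator v : PadicAlgCl 2)) * Polynomial.X ^ 2).comp (Polynomial.C ((Rat.HeightOneSpectrum.natGenerator v : PadicAlgCl 2)⁻¹) * (Polynomial.X + 1) ^ (PadicInt.toZModPow (n + 2) (-(Literature.NumberTheory.EllipticCurves.GreenbergVatsal2000.frobeniusExponent 2 (Rat.HeightOneSpectrum.natGenerator v : ℤ_[2])))).val) with hE2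
  set A : (PadicAlgCl 2)[X] :=
    (∑ i ∈ Finset.range (2 ^ n), C (plusSymbolK g Ω ((5 : ℚ) ^ i / (2 : ℚ) ^ (n + 2))) * (X + 1) ^ i).map ι with hA
  set B : (PadicAlgCl 2)[X] :=
    (∑ i ∈ Finset.range (2 ^ (n + 2)), C (plusSymbolK g Ω ((5 : ℚ) ^ i / (2 : ℚ) ^ (n + 2 + 2))) *
      (X + 1) ^ i).map ι with hB
  have hθn : ((Literature.NumberTheory.EllipticCurves.mazurTateElementK g Ω 2 n).map ι) = C (2 : PadicAlgCl 2) * A := map_mazurTateElementK_two_eq_C_two_mul_map_sum_range ι Ω n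
  have hθn2 : ((Literature.NumberTheory.EllipticCurves.mazurTateElementK g Ω 2 (n + 2)).map ι) = C (2 : PadicAlgCl 2) * B := map_mazurTateElementK_two_eq_C_two_mul_map_sum_range ι Ω (n + 2)
  rw [hθn, hθn2]
  have hνω : ν * ω0 = ω1 := X_add_one_pow_add_one_mul_layerModulus n
  have hω1m : ω1.Monic := monic_layerModulus (p := 2) (n + 1)
  have hω0m : ω0.Monic := monic_layerModulus (p := 2) n
  -- (1) the undepleted relation through `ι`: `ω1 ∣ B − (−ν A)`
  have h3 : B %ₘ ω1 = -(ν * A) := by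
    have hωm := monic_X_add_one_pow_two_pow_sub_one_field (coeffField g) (n + 1)
    have h0 := congr_arg (Polynomial.map ι) (halfLayer_three_term Ω hg h2M ha2 hΩ n)
    simp only [Polynomial.map_modByMonic ι hωm, Polynomial.map_sub, Polynomial.map_pow, Polynomial.map_add,
      Polynomial.map_X, Polynomial.map_one, Polynomial.map_neg, Polynomial.map_mul] at h0
    rw [hB, hν, hA]
    exact h0
  have hdB : ω1 ∣ B + ν * A := by
    have := modByMonic_add_div B ω1
    rw [h3] at this
    exact ⟨B /ₘ ω1, by linear_combination -this⟩
  -- (2) `ω0 ∣ E2 − E0` and `ω0 ∣ T_n − Θ_n`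
  have hdE : ω0 ∣ E2 - E0 := layerModulus_dvd_eulerProduct_add_two_sub ι S₀ n
  have hdT : ω0 ∣ C (2 : PadicAlgCl 2) * A * E0 - (C (2 : PadicAlgCl 2) * A * E0) %ₘ ω0 := by
    have := modByMonic_add_div (C (2 : PadicAlgCl 2) * A * E0) ω0
    exact ⟨(C (2 : PadicAlgCl 2) * A * E0) /ₘ ω0, by linear_combination -this⟩
  -- (3) `ω1 ∣ T_{n+2} − (−ν Θ_n)`
  have hkey : ω1 ∣ C (2 : PadicAlgCl 2) * B * E2 - -(ν * ((C (2 : PadicAlgCl 2) * A * E0) %ₘ ω0)) := by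
    have e : C (2 : PadicAlgCl 2) * B * E2 - -(ν * ((C (2 : PadicAlgCl 2) * A * E0) %ₘ ω0)) =
        C (2 : PadicAlgCl 2) * E2 * (B + ν * A) - ν * (C (2 : PadicAlgCl 2) * A * (E2 - E0)) -
          ν * (C (2 : PadicAlgCl 2) * A * E0 - (C (2 : PadicAlgCl 2) * A * E0) %ₘ ω0) := by ring
    rw [e]
    refine dvd_sub (dvd_sub (Dvd.dvd.mul_left hdB _) ?_) ?_
    · rw [← hνω]; exact mul_dvd_mul_left ν (Dvd.dvd.mul_left hdE _)
    · rw [← hνω]; exact mul_dvd_mul_left ν hdT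
  -- (4) reduce: `Θ_{n+2} %ₘ ω1 = T_{n+2} %ₘ ω1 = (−ν Θ_n) %ₘ ω1 = −ν Θ_n`
  have hred : (C (2 : PadicAlgCl 2) * B * E2) %ₘ ω2 %ₘ ω1 = (C (2 : PadicAlgCl 2) * B * E2) %ₘ ω1 := by
    apply modByMonic_eq_of_dvd_sub hω1m
    have := modByMonic_add_div (C (2 : PadicAlgCl 2) * B * E2) ω2
    refine ((layerModulus_dvd_layerModulus_succ (n + 1)).trans ⟨-((C (2 : PadicAlgCl 2) * B * E2) /ₘ ω2), ?_⟩)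
    rw [hω2]
    linear_combination this
  rw [hred, modByMonic_eq_of_dvd_sub hω1m hkey]
  refine (modByMonic_eq_self_iff hω1m).mpr (degree_lt_degree ?_)
  rw [natDegree_neg, show ω1.natDegree = 2 ^ (n + 1) from natDegree_layerModulus (p := 2) (n + 1)]
  refine (natDegree_mul_le).trans_lt ?_
  have hν' : ν.natDegree ≤ 2 ^ n := by
    refine (natDegree_add_le _ _).trans (max_le ?_ (by rw [natDegree_one]; exact Nat.zero_le _))
    rw [show (X + 1 : (PadicAlgCl 2)[X]) = X + C 1 by rw [C_1], natDegree_pow, natDegree_X_add_C, mul_one]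
  have hΘ : ((C (2 : PadicAlgCl 2) * A * E0) %ₘ ω0).natDegree < 2 ^ n := by
    have h := natDegree_modByMonic_lt (C (2 : PadicAlgCl 2) * A * E0) hω0m (by
      intro h1
      have := congr_arg natDegree h1
      rw [show ω0.natDegree = 2 ^ n from natDegree_layerModulus (p := 2) n, natDegree_one] at this
      exact absurd this (pow_ne_zero _ two_ne_zero))
    rwa [show ω0.natDegree = 2 ^ n from natDegree_layerModulus (p := 2) n] at h
  calc ν.natDegree + ((C (2 : PadicAlgCl 2) * A * E0) %ₘ ω0).natDegree < 2 ^ n + 2 ^ n :=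
        Nat.add_lt_add_of_le_of_lt hν' hΘ
    _ = 2 ^ (n + 1) := by rw [pow_succ]; ring

/-! ## §3. Depleted growth at a cohomological period -/

variable {ι Ω}

/-- **DEPLETED GROWTH at `p = 2`**: for a newform `g` on `Γ₀(M)`, `2 ∤ M`, `a₂(g) = 0`, a COHOMOLOGICAL plus period `Ω` along
`ι`, and `S₀` off `2`: if `‖Θ^{S₀}_n(g;Ω)‖_sup = ‖2‖₂` then `‖Θ^{S₀}_{n+2}(g;Ω)‖_sup = ‖2‖₂` and
`λ(Θ^{S₀}_{n+2}(g;Ω)) = λ(Θ^{S₀}_n(g;Ω)) + 2ⁿ` (norm squeeze `‖2‖ = ‖ν_nΘ_n‖ = ‖Θ_{n+2} %ₘ ω_{n+1}‖ ≤ ‖Θ_{n+2}‖ ≤ ‖2‖`,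
reduction survival, `λ(ν_n) = 2ⁿ`). [cite: PollackWeston2011MT, Thm. 4.1 (λ(θ_n) = q_n + λ; read at 2 for imprimitive elements)] -/
theorem depletedPartnerLayer_growth (hg : IsNewform0 g) (h2M : ¬ 2 ∣ M) (ha2 : cuspCoeff g 2 = 0)
    (h : IsCohomologicalPlusPeriod g ι Ω)
    (hS2 : ∀ v ∈ S₀, ((2 : ℕ) : NumberField.RingOfIntegers ℚ) ∉ v.asIdeal) {n : ℕ}
    (hμ : (((Literature.NumberTheory.EllipticCurves.mazurTateElementK g Ω 2 n).map ι * ∏ v ∈ S₀, (1 - Polynomial.C (Literature.NumberTheory.EllipticCurves.embCoeff g ι (Rat.HeightOneSpectrum.natGenerator v)) * Polynomial.X + (if Rat.HeightOneSpectrum.natGenerator v ∣ M then 0 else Polynomial.C (Rat.HeightOneSpectrum.natGenerator v : PadicAlgCl 2)) * Polynomial.X ^ 2).comp (Polynomial.C ((Rat.HeightOneSpectrum.natGenerator v : PadicAlgCl 2)⁻¹) * (Polynomial.X + 1) ^ (PadicInt.toZModPow n (-(Literature.NumberTheory.EllipticCurves.GreenbergVatsal2000.frobeniusExponent 2 (Rat.HeightOneSpectrum.natGenerator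 v : ℤ_[2])))).val)) %ₘ ((Polynomial.X + 1) ^ 2 ^ n - 1)).supNorm = ‖(2 : PadicAlgCl 2)‖) :
    (((Literature.NumberTheory.EllipticCurves.mazurTateElementK g Ω 2 (n + 2)).map ι * ∏ v ∈ S₀, (1 - Polynomial.C (Literature.NumberTheory.EllipticCurves.embCoeff g ι (Rat.HeightOneSpectrum.natGenerator v)) * Polynomial.X + (if Rat.HeightOneSpectrum.natGenerator v ∣ M then 0 else Polynomial.C (Rat.HeightOneSpectrum.natGenerator v : PadicAlgCl 2)) * Polynomial.X ^ 2).comp (Polynomial.C ((Rat.HeightOneSpectrum.natGenerator v : PadicAlgCl 2)⁻¹) * (Polynomial.X + 1) ^ (PadicInt.toZModPow (n + 2) (-(Literature.NumberTheory.EllipticCurves.GreenbergVatsal2000.frobeniusExponent 2 (Rat.HeightOneSpectrum.natGenerator v : ℤ_[2])))).val)) %ₘ ((Polynomial.X + 1) ^ 2 ^ (n + 2) - 1)).supNorm = ‖(2 : PadicAlgCl 2)‖ ∧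
      layerLambda (((Literature.NumberTheory.EllipticCurves.mazurTateElementK g Ω 2 (n + 2)).map ι * ∏ v ∈ S₀, (1 - Polynomial.C (Literature.NumberTheory.EllipticCurves.embCoeff g ι (Rat.HeightOneSpectrum.natGenerator v)) * Polynomial.X + (if Rat.HeightOneSpectrum.natGenerator v ∣ M then 0 else Polynomial.C (Rat.HeightOneSpectrum.natGenerator v : PadicAlgCl 2)) * Polynomial.X ^ 2).comp (Polynomial.C ((Rat.HeightOneSpectrum.natGenerator v : PadicAlgCl 2)⁻¹) * (Polynomial.X + 1) ^ (PadicInt.toZModPow (n + 2) (-(Literature.NumberTheory.EllipticCurves.GreenbergVatsal2000.frobeniusExponent 2 (Rat.HeightOneSpectrum.natGenerator v : ℤ_[2])))).val)) %ₘ ((Polynomial.X + 1) ^ 2 ^ (n + 2) - 1)) = layerLambda (((Literature.NumberTheory.EllipticCurves.mazurTateElementK g Ω 2 n).map ι * ∏ v ∈ S₀, (1 - Polynomial.C (Literature.NumberTheory.EllipticCurves.embCoeff g ι (Rat.HeightOneSpectrum.natGenerator v)) * Polynomial.X + (if Rat.HeightOneSpectrum.natGenerator v ∣ M then 0 else Polynomial.C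 (Rat.HeightOneSpectrum.natGenerator v : PadicAlgCl 2)) * Polynomial.X ^ 2).comp (Polynomial.C ((Rat.HeightOneSpectrum.natGenerator v : PadicAlgCl 2)⁻¹) * (Polynomial.X + 1) ^ (PadicInt.toZModPow n (-(Literature.NumberTheory.EllipticCurves.GreenbergVatsal2000.frobeniusExponent 2 (Rat.HeightOneSpectrum.natGenerator v : ℤ_[2])))).val)) %ₘ ((Polynomial.X + 1) ^ 2 ^ n - 1)) + 2 ^ n := by
  obtain ⟨hPn, hPl⟩ := supNorm_and_layerLambda_X_add_one_pow_two_pow_add_one n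
  set P : (PadicAlgCl 2)[X] := (X + 1) ^ 2 ^ n + 1 with hP
  set Θ0 : (PadicAlgCl 2)[X] := (((Literature.NumberTheory.EllipticCurves.mazurTateElementK g Ω 2 n).map ι * ∏ v ∈ S₀, (1 - Polynomial.C (Literature.NumberTheory.EllipticCurves.embCoeff g ι (Rat.HeightOneSpectrum.natGenerator v)) * Polynomial.X + (if Rat.HeightOneSpectrum.natGenerator v ∣ M then 0 else Polynomial.C (Rat.HeightOneSpectrum.natGenerator v : PadicAlgCl 2)) * Polynomial.X ^ 2).comp (Polynomial.C ((Rat.HeightOneSpectrum.natGenerator v : PadicAlgCl 2)⁻¹) * (Polynomial.X + 1) ^ (PadicInt.toZModPow n (-(Literature.NumberTheory.EllipticCurves.GreenbergVatsal2000.frobeniusExponent 2 (Rat.HeightOneSpectrum.natGenerator v : ℤ_[2])))).val)) %ₘ ((Polynomial.X + 1) ^ 2 ^ n - 1)) with hΘ0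
  set Θ2 : (PadicAlgCl 2)[X] := (((Literature.NumberTheory.EllipticCurves.mazurTateElementK g Ω 2 (n + 2)).map ι * ∏ v ∈ S₀, (1 - Polynomial.C (Literature.NumberTheory.EllipticCurves.embCoeff g ι (Rat.HeightOneSpectrum.natGenerator v)) * Polynomial.X + (if Rat.HeightOneSpectrum.natGenerator v ∣ M then 0 else Polynomial.C (Rat.HeightOneSpectrum.natGenerator v : PadicAlgCl 2)) * Polynomial.X ^ 2).comp (Polynomial.C ((Rat.HeightOneSpectrum.natGenerator v : PadicAlgCl 2)⁻¹) * (Polynomial.X + 1) ^ (PadicInt.toZModPow (n + 2) (-(Literature.NumberTheory.EllipticCurves.GreenbergVatsal2000.frobeniusExponent 2 (Rat.HeightOneSpectrum.natGenerator v : ℤ_[2])))).val)) %ₘ ((Polynomial.X + 1) ^ 2 ^ (n + 2) - 1)) with hΘ2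
  have h2 : (0 : ℝ) < ‖(2 : PadicAlgCl 2)‖ := norm_pos_iff.mpr two_ne_zero
  have h3 : Θ2 %ₘ ((X + 1) ^ 2 ^ (n + 1) - 1) = -(P * Θ0) :=
    depletedPartnerLayer_three_term ι Ω S₀ hg h2M ha2 h.isPlusPeriod n
  have hle : Θ2.supNorm ≤ ‖(2 : PadicAlgCl 2)‖ := supNorm_depletedPartnerLayer_le hg h M S₀ hS2 (n + 2)
  have hRn : (-(P * Θ0)).supNorm = ‖(2 : PadicAlgCl 2)‖ := by
    rw [show -(P * Θ0) = C (-1 : PadicAlgCl 2) * (P * Θ0) by simp, supNorm_C_mul, norm_neg, norm_one, one_mul,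
      supNorm_mul', hPn, hμ, one_mul]
  have hΘ2n : Θ2.supNorm = ‖(2 : PadicAlgCl 2)‖ := by
    refine le_antisymm hle ?_
    rw [← hRn, ← h3]
    exact supNorm_modByMonic_le (monic_layerModulus (p := 2) (n + 1)) (supNorm_layerModulus_le_one (p := 2) (n + 1)) Θ2
  have hΘ2z : Θ2 ≠ 0 := fun h0 ↦ by rw [h0, supNorm_zero] at hΘ2n; exact h2.ne hΘ2n
  have hΘ0z : Θ0 ≠ 0 := fun h0 ↦ by rw [h0, supNorm_zero] at hμ; exact h2.ne hμ
  have hP0 : P ≠ 0 := fun h0 ↦ by rw [h0, supNorm_zero] at hPn; exact zero_ne_one hPn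
  have hsurv : (Θ2 %ₘ ((X + 1) ^ 2 ^ (n + 1) - 1)).supNorm = Θ2.supNorm := by rw [h3, hRn, hΘ2n]
  have hlam2 : layerLambda Θ2 < 2 ^ (n + 1) :=
    (supNorm_modByMonic_layerModulus_eq_iff (p := 2) (n + 1) hΘ2z).mp hsurv
  refine ⟨hΘ2n, ?_⟩
  rw [← (layerLambda_modByMonic_layerModulus (p := 2) (n + 1) hΘ2z hlam2).2, h3,
    show -(P * Θ0) = C (-1 : PadicAlgCl 2) * (P * Θ0) by simp,
    ResidualThetaLayer.layerLambda_C_mul (neg_ne_zero.mpr one_ne_zero), layerLambda_mul hP0 hΘ0z, hPl, add_comm]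

/-- **Iterated depleted growth**: under the same hypotheses, `‖Θ^{S₀}_{n+2k}(g;Ω)‖_sup = ‖2‖₂` and
`3·λ(Θ^{S₀}_{n+2k}(g;Ω)) + 2ⁿ = 3·λ(Θ^{S₀}_n(g;Ω)) + 2ⁿ·4^k` for every `k` — the depleted analytic layer law
`λ_{n+2k} = λ_n + 2ⁿ(4^k − 1)/3`. [cite: PollackWeston2011MT, Thm. 4.1 (read at 2, imprimitive)] -/
theorem depletedPartnerLayer_growth_mul (hg : IsNewform0 g) (h2M : ¬ 2 ∣ M) (ha2 : cuspCoeff g 2 = 0)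
    (h : IsCohomologicalPlusPeriod g ι Ω)
    (hS2 : ∀ v ∈ S₀, ((2 : ℕ) : NumberField.RingOfIntegers ℚ) ∉ v.asIdeal) {n : ℕ}
    (hμ : (((Literature.NumberTheory.EllipticCurves.mazurTateElementK g Ω 2 n).map ι * ∏ v ∈ S₀, (1 - Polynomial.C (Literature.NumberTheory.EllipticCurves.embCoeff g ι (Rat.HeightOneSpectrum.natGenerator v)) * Polynomial.X + (if Rat.HeightOneSpectrum.natGenerator v ∣ M then 0 else Polynomial.C (Rat.HeightOneSpectrum.natGenerator v : PadicAlgCl 2)) * Polynomial.X ^ 2).comp (Polynomial.C ((Rat.HeightOneSpectrum.natGenerator v : PadicAlgCl 2)⁻¹) * (Polynomial.X + 1) ^ (PadicInt.toZModPow n (-(Literature.NumberTheory.EllipticCurves.GreenbergVatsal2000.frobeniusExponent 2 (Rat.HeightOneSpectrum.natGenerator v : ℤ_[2])))).val)) %ₘ ((Polynomial.X + 1) ^ 2 ^ n - 1)).supNorm = ‖(2 : PadicAlgCl 2)‖) (k : ℕ) :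
    (((Literature.NumberTheory.EllipticCurves.mazurTateElementK g Ω 2 (n + 2 * k)).map ι * ∏ v ∈ S₀, (1 - Polynomial.C (Literature.NumberTheory.EllipticCurves.embCoeff g ι (Rat.HeightOneSpectrum.natGenerator v)) * Polynomial.X + (if Rat.HeightOneSpectrum.natGenerator v ∣ M then 0 else Polynomial.C (Rat.HeightOneSpectrum.natGenerator v : PadicAlgCl 2)) * Polynomial.X ^ 2).comp (Polynomial.C ((Rat.HeightOneSpectrum.natGenerator v : PadicAlgCl 2)⁻¹) * (Polynomial.X + 1) ^ (PadicInt.toZModPow (n + 2 * k) (-(Literature.NumberTheory.EllipticCurves.GreenbergVatsal2000.frobeniusExponent 2 (Rat.HeightOneSpectrum.natGenerator v : ℤ_[2])))).val)) %ₘ ((Polynomial.X + 1) ^ 2 ^ (n + 2 * k) - 1)).supNorm = ‖(2 : PadicAlgCl 2)‖ ∧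
      3 * layerLambda (((Literature.NumberTheory.EllipticCurves.mazurTateElementK g Ω 2 (n + 2 * k)).map ι * ∏ v ∈ S₀, (1 - Polynomial.C (Literature.NumberTheory.EllipticCurves.embCoeff g ι (Rat.HeightOneSpectrum.natGenerator v)) * Polynomial.X + (if Rat.HeightOneSpectrum.natGenerator v ∣ M then 0 else Polynomial.C (Rat.HeightOneSpectrum.natGenerator v : PadicAlgCl 2)) * Polynomial.X ^ 2).comp (Polynomial.C ((Rat.HeightOneSpectrum.natGenerator v : PadicAlgCl 2)⁻¹) * (Polynomial.X + 1) ^ (PadicInt.toZModPow (n + 2 * k) (-(Literature.NumberTheory.EllipticCurves.GreenbergVatsal2000.frobeniusExponent 2 (Rat.HeightOneSpectrum.natGenerator v : ℤ_[2])))).val)) %ₘ ((Polynomial.X + 1) ^ 2 ^ (n + 2 * k) - 1)) + 2 ^ n = 3 * layerLambda (((Literature.NumberTheory.EllipticCurves.mazurTateElementK g Ω 2 n).map ι * ∏ v ∈ S₀, (1 - Polynomial.C (Literature.NumberTheory.EllipticCurves.embCoeff g ι (Rat.HeightOneSpectrum.natGenerator v)) * Polynomial.X + (if Rat.HeightOneSpectrum.natGenerator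 v ∣ M then 0 else Polynomial.C (Rat.HeightOneSpectrum.natGenerator v : PadicAlgCl 2)) * Polynomial.X ^ 2).comp (Polynomial.C ((Rat.HeightOneSpectrum.natGenerator v : PadicAlgCl 2)⁻¹) * (Polynomial.X + 1) ^ (PadicInt.toZModPow n (-(Literature.NumberTheory.EllipticCurves.GreenbergVatsal2000.frobeniusExponent 2 (Rat.HeightOneSpectrum.natGenerator v : ℤ_[2])))).val)) %ₘ ((Polynomial.X + 1) ^ 2 ^ n - 1)) + 2 ^ n * 4 ^ k := by
  induction k with
  | zero => exact ⟨by simpa using hμ, by simp⟩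
  | succ k ih =>
    obtain ⟨hμk, hlk⟩ := ih
    obtain ⟨hμ', hl'⟩ := depletedPartnerLayer_growth S₀ hg h2M ha2 h hS2 hμk
    change (((Literature.NumberTheory.EllipticCurves.mazurTateElementK g Ω 2 (n + 2 * k + 2)).map ι * ∏ v ∈ S₀, (1 - Polynomial.C (Literature.NumberTheory.EllipticCurves.embCoeff g ι (Rat.HeightOneSpectrum.natGenerator v)) * Polynomial.X + (if Rat.HeightOneSpectrum.natGenerator v ∣ M then 0 else Polynomial.C (Rat.HeightOneSpectrum.natGenerator v : PadicAlgCl 2)) * Polynomial.X ^ 2).comp (Polynomial.C ((Rat.HeightOneSpectrum.natGenerator v : PadicAlgCl 2)⁻¹) * (Polynomial.X + 1) ^ (PadicInt.toZModPow (n + 2 * k + 2) (-(Literature.NumberTheory.EllipticCurves.GreenbergVatsal2000.frobeniusExponent 2 (Rat.HeightOneSpectrum.natGenerator v : ℤ_[2])))).val)) %ₘ ((Polynomial.X + 1) ^ 2 ^ (n + 2 * k + 2) - 1)).supNorm = ‖(2 : PadicAlgCl 2)‖ ∧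
      3 * layerLambda (((Literature.NumberTheory.EllipticCurves.mazurTateElementK g Ω 2 (n + 2 * k + 2)).map ι * ∏ v ∈ S₀, (1 - Polynomial.C (Literature.NumberTheory.EllipticCurves.embCoeff g ι (Rat.HeightOneSpectrum.natGenerator v)) * Polynomial.X + (if Rat.HeightOneSpectrum.natGenerator v ∣ M then 0 else Polynomial.C (Rat.HeightOneSpectrum.natGenerator v : PadicAlgCl 2)) * Polynomial.X ^ 2).comp (Polynomial.C ((Rat.HeightOneSpectrum.natGenerator v : PadicAlgCl 2)⁻¹) * (Polynomial.X + 1) ^ (PadicInt.toZModPow (n + 2 * k + 2) (-(Literature.NumberTheory.EllipticCurves.GreenbergVatsal2000.frobeniusExponent 2 (Rat.HeightOneSpectrum.natGenerator v : ℤ_[2])))).val)) %ₘ ((Polynomial.X + 1) ^ 2 ^ (n + 2 * k + 2) - 1)) + 2 ^ n = 3 * layerLambda (((Literature.NumberTheory.EllipticCurves.mazurTateElementK g Ω 2 n).map ι * ∏ v ∈ S₀, (1 - Polynomial.C (Literature.NumberTheory.EllipticCurves.embCoeff g ι (Rat.HeightOneSpectrum.natGenerator v)) * Polynomial.X + (if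 Rat.HeightOneSpectrum.natGenerator v ∣ M then 0 else Polynomial.C (Rat.HeightOneSpectrum.natGenerator v : PadicAlgCl 2)) * Polynomial.X ^ 2).comp (Polynomial.C ((Rat.HeightOneSpectrum.natGenerator v : PadicAlgCl 2)⁻¹) * (Polynomial.X + 1) ^ (PadicInt.toZModPow n (-(Literature.NumberTheory.EllipticCurves.GreenbergVatsal2000.frobeniusExponent 2 (Rat.HeightOneSpectrum.natGenerator v : ℤ_[2])))).val)) %ₘ ((Polynomial.X + 1) ^ 2 ^ n - 1)) + 2 ^ n * 4 ^ (k + 1)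
    refine ⟨hμ', ?_⟩
    rw [hl']
    have e2 : (2 : ℕ) ^ (n + 2 * k) = 2 ^ n * 4 ^ k := by
      rw [pow_add, pow_mul]; norm_num
    linear_combination hlk + 3 * e2

end Depleted

end Summit.BirchSwinnertonDyer.BirchSwinnertonDyer.Theorems.ThetaLayerLambdaCongruenceAtTwo

end
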